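import Literature.NumberTheory.EllipticCurves.BertoliniDarmonPrasanna2013.WaldspurgerHeegnerPoints
import Summits.BirchSwinnertonDyer.BirchSwinnertonDyer.Theorems.ClassRecordThreeOpenValueReciprocityOfWaldspurger
import HarnessLib

/-!
# Routes `ClassRecordThree` ∕ `KolyvaginRoadThree`, item stmt-BirchSwinnertonDyer-19281 `OpenValueReciprocityAtThree`
# (SHARP K5-B) from the two ATOMS of BDP13 (5.1.16): the explicit Waldspurger identity at the Heegner points
# (Thm. 5.4 (5.1.12)) and Shimura's algebraicity of Shimura–Maass derivatives at CM points (Prop. 1.12 (1))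

Cell `bsd-stepL` (run/shared/lean/pub/bsd-stepL/), seat `bsd-stepL-desc3-p1x` (WIDTH-LEVER second prover lane on item
19281), `--supports stmt-BirchSwinnertonDyer-19281`. Sequel of `ClassRecordThreeOpenValueReciprocityOfWaldspurger.lean`
(ROAD W: `thm54_bdpLalg_eq_sq_sum_cmValues` ⟹ p419864's reciprocity ⟹ 19281). ROAD W′: the square-root-shape fact is
itself DERIVED here from the two Literature atoms of `BertoliniDarmonPrasanna2013/WaldspurgerHeegnerPoints.lean`, in
which the CM values are DEFINED objects (`maassShimuraIter 2 (n−1)` of `z ↦ f(ofComplex z)` at `heegnerTau Q`):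

* `thm54_bdpLalg_eq_sq_sum_cmValues_of_atoms : thm54_bdpLalg_eq_sq_sum_heegnerPoints →
    prop112_shimura_maassShimuraIter_heegnerTau_mem → thm54_bdpLalg_eq_sq_sum_cmValues` — take
  `V_𝔞 := ∑_{i : 𝔞_i = 𝔞} a_i·(δ_2^{n−1}f)(τ_{Q_i})·κ^{2n}/(κΩ)^{2n}` (in `F`: `a_i ∈ e(K) ⊂ F`, Shimura), period `κ·Ω`;
  `L_alg(Ω′) = L_alg(1)/Ω′^{4n}` and the sum over the family regrouped by its ideal coordinate
  (`Finset.sum_fiberwise_of_maps_to`).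
* `bdp2013_centralValue_reciprocity_of_atoms`, `openValueReciprocityAtThree_of_atoms` (+ `KolyvaginRoadThree` copy),
  `classRecordThree_hsiehDescentAtThree_of_atoms_of_hsieh2014_unrPeriod` (+ copy) — the K5-B chain and the parent crux
  19108 from {the two atoms (+ Hsieh 2014 Thm. 5.6 with `Ω_p ∈ 𝒲^×` for the parent)}.

HONEST FRAMING: CONDITIONAL results on two (resp. three) PUBLISHED theorems carried as named facts; items 19281 ∕ 19108
are NOT closed by these theorems; nothing booked (T7); BSD is not proved by any of this. NET EFFECT on the trust base of
K5-B: {one print-shaped fact with ∃-quantified CM values} ↦ {an analytic identity at defined Heegner points, Shimura's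
CM algebraicity at the same points} — each numerically testable ∕ classically famous on its own.

References: [BertoliniDarmonPrasanna2013] (1.2.2), (1.2.9), Lemma 1.5, Prop. 1.12 (1), (4.1.2)–(4.1.4), Thm. 5.4
(5.1.12), (5.1.15)–(5.1.16); [Shimura1975Arith]; [Gross1984] §I.1; [Hsieh2014] Thm. 5.6.
-/

noncomputable section

open scoped NumberField BigOperators
open NumberField IsDedekindDomain
open Literature.NumberTheory.GaloisRepresentations
open Literature.NumberTheory.EllipticCurves
open Literature.NumberTheory.EllipticCurves.ModularForms
open Literature.NumberTheory.EllipticCurves.BertoliniDarmonPrasanna2013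

namespace Summit.BirchSwinnertonDyer.BirchSwinnertonDyer.Theorems

/-- **The square-root-shape fact `thm54_bdpLalg_eq_sq_sum_cmValues` (BDP13 (5.1.16) with χ-free coefficients in
`H(i)`) FOLLOWS from its two printed atoms**: Thm. 5.4 (5.1.12) read at the Heegner points
(`thm54_bdpLalg_eq_sq_sum_heegnerPoints`) and Prop. 1.12 (1) = Shimura's algebraicity of the Shimura–Maass
derivatives at those points (`prop112_shimura_maassShimuraIter_heegnerTau_mem`). Proof: the `χ`-free coefficient of
the ideal `𝔞` is `V_𝔞 := ∑_{i : 𝔞_i = 𝔞} a_i·(δ_2^{n−1}f)(τ_{Q_i})/Ω^{2n}` (in `F`), the period is `κ·Ω`, and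
`L_alg(κΩ) = L_alg(1)/(κΩ)^{4n}`. [cite: BertoliniDarmonPrasanna2013, Thm. 5.4 (5.1.12) (p. 59), (5.1.15)–(5.1.16) (p. 60), Prop. 1.12 (1) (p. 14)] -/
theorem thm54_bdpLalg_eq_sq_sum_cmValues_of_atoms (h1 : thm54_bdpLalg_eq_sq_sum_heegnerPoints)
    (h2 : prop112_shimura_maassShimuraIter_heegnerTau_mem) : thm54_bdpLalg_eq_sq_sum_cmValues := by
  intro W _ K _ _ N _ f hnf hN hK hodd hHeeg
  obtain ⟨κ, wf, bN, 𝔟, sf, hκ, hwf, hbN, ⟨e₀, x₀, hx₀⟩, h𝔟, hfam⟩ := h1 W K f hnf hN hK hodd hHeeg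
  obtain ⟨Ω, F, hΩ, hFfin, hKF, hIF, hram, hmem⟩ := h2 W K f hnf hN hK hodd hHeeg
  refine ⟨κ * Ω, wf, bN, 𝔟, sf, F, mul_ne_zero hκ hΩ, ?_, hbN, h𝔟, hFfin, hKF, hIF, ?_, ?_, hram, ?_⟩
  · rcases hwf with h | h <;> simp [h]
  · rcases hwf with h | h
    · rw [h]; exact one_mem F
    · rw [h]; exact neg_mem (one_mem F)
  · rw [← hx₀]; exact hKF e₀ x₀
  intro n hn
  obtain ⟨A, a, hA, hform⟩ := hfam n hn
  -- the χ-free coefficients `V_i := a_i · (δ^{n-1} f)(τ_i) / Ω^{2n}`, indexed by ideals after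
  -- collapsing the family along `i ↦ i.1`? No: keep the family indexed by `A` itself and push it to
  -- a Finset of ideals only if injective — instead use the ideal family `A.image Prod.fst` with
  -- coefficients summed over the fibres.
  classical
  let δf : (ℤ × ℤ × ℤ) → ℂ := fun Q ↦
    maassShimuraIter 2 (n - 1) (fun z ↦ f (UpperHalfPlane.ofComplex z)) ((heegnerTau Q : UpperHalfPlane) : ℂ)
  let V : Ideal (𝓞 K) → ℂ := fun 𝔞 ↦
    ∑ i ∈ A.filter (fun i ↦ i.1 = 𝔞), a i * δf i.2 * κ ^ (2 * n) / (κ * Ω) ^ (2 * n)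
  refine ⟨A.image Prod.fst, V, ?_, ?_⟩
  · intro 𝔞 h𝔞
    refine sum_mem fun i hi ↦ ?_
    have hiA : i ∈ A := (Finset.mem_filter.mp hi).1
    obtain ⟨hQ, -, e, y, hy⟩ := hA i hiA
    have hδ : δf i.2 / Ω ^ (2 + 2 * (n - 1)) ∈ F := hmem (n - 1) i.2 hQ
    have h2n : 2 + 2 * (n - 1) = 2 * n := by omega
    rw [h2n] at hδ
    have hrw : a i * δf i.2 * κ ^ (2 * n) / (κ * Ω) ^ (2 * n) = a i * (δf i.2 / Ω ^ (2 * n)) := by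
      rw [mul_pow]
      field_simp
    rw [hrw, ← hy]
    exact mul_mem (hKF e y) hδ
  · intro φ hunr hφ
    have hmain := hform φ hunr hφ
    -- bdpLalg at Ω' = bdpLalg at 1 divided by Ω'^{4n}
    have hscale : bdpLalg f sf wf 𝔟 N bN (κ * Ω) φ n =
        bdpLalg f sf wf 𝔟 N bN 1 φ n / (κ * Ω) ^ (4 * n) := by
      unfold bdpLalg; rw [one_pow, div_one]
    rw [hscale, hmain]
    set ρ : ℂ := κ ^ (2 * n) / (κ * Ω) ^ (2 * n) with hρ
    set T : Ideal (𝓞 K) × (ℤ × ℤ × ℤ) → ℂ := fun i ↦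
      (heckeIdealValueExtZero φ i.1 * ((Ideal.absNorm i.1 : ℕ) : ℂ) ^ n)⁻¹ * a i * δf i.2 with hT
    have hV : ∑ x ∈ A.image Prod.fst,
        (heckeIdealValueExtZero φ x * ((Ideal.absNorm x : ℕ) : ℂ) ^ n)⁻¹ * V x = ∑ i ∈ A, T i * ρ := by
      have hfib := Finset.sum_fiberwise_of_maps_to (s := A) (t := A.image Prod.fst) (g := Prod.fst)
        (fun i hi ↦ Finset.mem_image_of_mem Prod.fst hi) (fun i ↦ T i * ρ)
      rw [← hfib]
      refine Finset.sum_congr rfl fun x _ ↦ ?_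
      simp only [V, Finset.mul_sum]
      refine Finset.sum_congr rfl fun i hi ↦ ?_
      have hix : i.1 = x := (Finset.mem_filter.mp hi).2
      rw [← hix, hT, hρ]
      ring
    rw [hV, ← Finset.sum_mul, hρ]
    field_simp
    ring


/-- **BDP13's `Aut(ℂ/H(i))`-reciprocity of `L(f/K,χ,1)/(π^{2n+1}Ω^{4n})` (p419864's `Prop`) from the two atoms.**
[cite: BertoliniDarmonPrasanna2013, Thm. 5.4 (5.1.12), Thm. 5.5 (pp. 59–60)] -/
theorem bdp2013_centralValue_reciprocity_of_atoms (h1 : thm54_bdpLalg_eq_sq_sum_heegnerPoints)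
    (h2 : prop112_shimura_maassShimuraIter_heegnerTau_mem) :
    bertoliniDarmonPrasanna2013_centralValue_reciprocity :=
  WaldspurgerReciprocity.bdp2013_centralValue_reciprocity_of_waldspurgerSq
    (thm54_bdpLalg_eq_sq_sum_cmValues_of_atoms h1 h2)

/-- **Item `stmt-BirchSwinnertonDyer-19281` (`Theses.ClassRecordThree.OpenValueReciprocityAtThree`) from the two
atoms** (explicit Waldspurger at Heegner points + Shimura). CONDITIONAL; the item is not closed by this theorem.
[cite: BertoliniDarmonPrasanna2013, Thm. 5.4 (5.1.12) (p. 59), Prop. 1.12 (1) (p. 14)] -/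
theorem openValueReciprocityAtThree_of_atoms (h1 : thm54_bdpLalg_eq_sq_sum_heegnerPoints)
    (h2 : prop112_shimura_maassShimuraIter_heegnerTau_mem) :
    Summit.BirchSwinnertonDyer.BirchSwinnertonDyer.Theses.ClassRecordThree.OpenValueReciprocityAtThree :=
  openValueReciprocityAtThree_of_waldspurgerSq (thm54_bdpLalg_eq_sq_sum_cmValues_of_atoms h1 h2)

/-- **The `KolyvaginRoadThree` copy of item 19281 from the two atoms.**
[cite: BertoliniDarmonPrasanna2013, Thm. 5.4 (5.1.12) (p. 59), Prop. 1.12 (1) (p. 14)] -/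
theorem kolyvaginRoadThree_openValueReciprocityAtThree_of_atoms (h1 : thm54_bdpLalg_eq_sq_sum_heegnerPoints)
    (h2 : prop112_shimura_maassShimuraIter_heegnerTau_mem) :
    Summit.BirchSwinnertonDyer.BirchSwinnertonDyer.Theses.KolyvaginRoadThree.OpenValueReciprocityAtThree :=
  kolyvaginRoadThree_openValueReciprocityAtThree_of_waldspurgerSq (thm54_bdpLalg_eq_sq_sum_cmValues_of_atoms h1 h2)

/-- **The parent crux `HsiehDescentAtThree` (item 19108) from the two atoms and Hsieh 2014 Thm. 5.6 with
`Ω_p ∈ 𝒲^×`** (via lane A's p451946). CONDITIONAL. [cite: BertoliniDarmonPrasanna2013, (5.1.16) (p. 60)] [cite: Hsieh2014, Thm. 5.6] -/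
theorem classRecordThree_hsiehDescentAtThree_of_atoms_of_hsieh2014_unrPeriod
    (h1 : thm54_bdpLalg_eq_sq_sum_heegnerPoints) (h2 : prop112_shimura_maassShimuraIter_heegnerTau_mem)
    (hH : hsieh2014_exists_anticyclotomicPAdicLFunction_unrPeriod) :
    Summit.BirchSwinnertonDyer.BirchSwinnertonDyer.Theses.ClassRecordThree.HsiehDescentAtThree :=
  classRecordThree_hsiehDescentAtThree_of_waldspurgerSq_of_hsieh2014_unrPeriod
    (thm54_bdpLalg_eq_sq_sum_cmValues_of_atoms h1 h2) hH

/-- **The `KolyvaginRoadThree` copy of the parent crux from the same three facts.**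
[cite: BertoliniDarmonPrasanna2013, (5.1.16) (p. 60)] [cite: Hsieh2014, Thm. 5.6] -/
theorem kolyvaginRoadThree_hsiehDescentAtThree_of_atoms_of_hsieh2014_unrPeriod
    (h1 : thm54_bdpLalg_eq_sq_sum_heegnerPoints) (h2 : prop112_shimura_maassShimuraIter_heegnerTau_mem)
    (hH : hsieh2014_exists_anticyclotomicPAdicLFunction_unrPeriod) :
    Summit.BirchSwinnertonDyer.BirchSwinnertonDyer.Theses.KolyvaginRoadThree.HsiehDescentAtThree :=
  kolyvaginRoadThree_hsiehDescentAtThree_of_waldspurgerSq_of_hsieh2014_unrPeriod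
    (thm54_bdpLalg_eq_sq_sum_cmValues_of_atoms h1 h2) hH

end Summit.BirchSwinnertonDyer.BirchSwinnertonDyer.Theorems

end
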